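import Mathlib
import HarnessLib
import Literature.Analysis.FluidPDE.VectorCalculus
import Summits.NavierStokesRegularity.NavierStokesRegularity.Theorems.UnthreadedDoorAntidynamoEvenRungSeparation

/-!
# Route `UnthreadedDoor` / `ThreadingFlux`, crux `PoloidalLiouville` (stmt-NavierStokesRegularity-1222), antidynamo v2 skeleton,
# rung `stub_singleDegreeRung`, EVEN degree — THE `d ≡ 0` ODE BRANCH (kinematic half): if the vorticity amplitude `G` and the
# `∇P`-coefficient `k` satisfy `G·k ≡ 0` on `(0,∞)`, then `G ≡ 0`

Support file (census instrument decomp-ns-census-1 g31, cell decomp-ns; `--supports stmt-NavierStokesRegularity-1222 --as helper`; 0 kit).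

Reading of the coefficients (hand g1: `curl_singleDegreeField` / `divergence_singleDegreeField`, p800499; `curl_lamb_eq_radial`, p800175):
for the single-degree field `V = (a(r)P)•y + k(r)•∇P` (`P` a solid harmonic of degree `l`, `r = ‖y‖`) one has
`curl V = G•(∇P × y)` with `G = a − k′/r`, `div V = (r a′ + (l+3)a + l k′/r) P`, and the coefficient of `∇|∇P|² × y` in the curled Lamb
vector is `d = G·k`.  The census's (E3) extraction (`evenRung_dichotomy_of_lamb_identity`, p810874) splits the even rung at one time slice
into `d ≡ 0 on (0,∞)` OR `l = 2 ∧ P zonal`.  THIS FILE SETTLES THE FIRST ALTERNATIVE KINEMATICALLY, as one-variable analysis on `(0,∞)`: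

* `eq_zero_of_analytic_mul_eq_zero` — `G` real-analytic on `(0,∞)` with `G r₀ ≠ 0` for some `r₀ > 0`, `k` continuous on `(0,∞)`,
  `G·k ≡ 0` ⟹ `k ≡ 0` on `(0,∞)` (isolated zeros);
* `radialAmp_mul_pow_eq_const` — `k′ ≡ 0` and the divergence relation `r a′ + (l+3)a + l k′/r = 0` ⟹ `a(r)·r^{l+3}` is constant on `(0,∞)`;
* ★★ `odeBranch_vortAmp_eq_zero` — `a, k` differentiable and `G` analytic on `(0,∞)`, `G = a − k′/r`, the divergence relation, `G·k ≡ 0`,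
  and `|G(r)|·r^l` bounded on `(0,1)` (continuity of the vorticity at the centre: `∇P × y` is homogeneous of degree `l`) ⟹ `G ≡ 0` on
  `(0,∞)` [if not, `k ≡ 0`, so `G = a = C·r^{−(l+3)}` with `C ≠ 0`, and `|G|r^l = |C|r^{−3}` is unbounded at `0⁺`];
* ★★ `evenRung_slice_alternative` — COROLLARY with p810874: under the single-degree vorticity identity at one time slice (with
  `d := G·k`) and the hypotheses above, EITHER `G ≡ 0` on `(0,∞)` (the slice's vorticity vanishes off the centre) OR `l = 2 ∧ IsZonal Y`.

What remains of the even rung after this file: the (E1) assembly at the centre (extracting `a, k, G` with these regularities from the rung's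
junk representation `v = ∇φ + (gP)•y` and delivering the identity), and the KNSS transfer for the zonal quadratic; the WALL is untouched.

HONEST LABEL: elementary real analysis serving the open EVEN-degree rung of an S-free Liouville engine; the rung, the wall
`stub_scalarLiouville`, `PoloidalLiouville` (1222) and Navier–Stokes regularity are NOT touched (crux 1222 is INCOMPARABLE with the summit;
descent inside the door's cone, decorative for the summit).  Nothing here proves NavierStokesRegularity.  [folklore]
-/

noncomputable section

-- the summit and its single sub-problem share the name (CONVENTIONS §1), as in every Theorems file
set_option linter.dupNamespace false

open scoped Topology InnerProductSpace RealInnerProductSpace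
open Filter Set
open Literature.Analysis.FluidPDE

namespace Summit.NavierStokesRegularity.NavierStokesRegularity.Theorems.PoloidalLiouville.Antidynamo

open Summit.NavierStokesRegularity.NavierStokesRegularity.Theorems.UnthreadedRigidity.VirialHorn (IsSolidHarmonic IsZonal)

/-! ### Isolated zeros: `G·k ≡ 0` with `G ≢ 0` analytic forces `k ≡ 0` -/

/-- An analytic function on `(0,∞)` that does not vanish identically is non-zero on a punctured neighbourhood of EVERY point of
`(0,∞)`. [folklore] -/
theorem eventually_ne_zero_of_analyticOnNhd_Ioi {G : ℝ → ℝ} (hG : AnalyticOnNhd ℝ G (Ioi 0)) {r₀ : ℝ} (hr₀ : 0 < r₀)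
    (hG0 : G r₀ ≠ 0) {r : ℝ} (hr : 0 < r) : ∀ᶠ s in 𝓝[≠] r, G s ≠ 0 := by
  rcases (hG r hr).eventually_eq_zero_or_eventually_ne_zero with h | h
  · exfalso
    apply hG0
    have hfr : ∃ᶠ s in 𝓝[≠] r, G s = 0 := (h.filter_mono nhdsWithin_le_nhds).frequently
    exact hG.eqOn_zero_of_preconnected_of_frequently_eq_zero isPreconnected_Ioi hr hfr hr₀
  · exact h

/-- **`G·k ≡ 0`, `G` analytic and not identically zero ⟹ `k ≡ 0`** on `(0,∞)` (`k` continuous there). [folklore] -/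
theorem eq_zero_of_analytic_mul_eq_zero {G k : ℝ → ℝ} (hG : AnalyticOnNhd ℝ G (Ioi 0)) {r₀ : ℝ} (hr₀ : 0 < r₀)
    (hG0 : G r₀ ≠ 0) (hk : ∀ r, 0 < r → ContinuousAt k r) (hd : ∀ r, 0 < r → G r * k r = 0) :
    ∀ r, 0 < r → k r = 0 := by
  intro r hr
  have hpos : ∀ᶠ s in 𝓝[≠] r, 0 < s := nhdsWithin_le_nhds (Ioi_mem_nhds hr)
  have hev : ∀ᶠ s in 𝓝[≠] r, k s = 0 := by
    filter_upwards [eventually_ne_zero_of_analyticOnNhd_Ioi hG hr₀ hG0 hr, hpos] with s hs hs'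
    exact (mul_eq_zero.mp (hd s hs')).resolve_left hs
  have h1 : Tendsto k (𝓝[≠] r) (𝓝 (k r)) := (hk r hr).tendsto.mono_left nhdsWithin_le_nhds
  have h2 : Tendsto k (𝓝[≠] r) (𝓝 0) :=
    tendsto_const_nhds.congr' (hev.mono fun s hs => hs.symm)
  exact tendsto_nhds_unique h1 h2

/-! ### The divergence relation with `k′ ≡ 0`: `a = C·r^{−(l+3)}` -/

/-- **THE RADIAL ODE.**  If `k′ ≡ 0` on `(0,∞)` and `r a′ + (l+3)a + l k′/r = 0` there (`a` differentiable on `(0,∞)`), then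
`a(r)·r^{l+3} = a(1)` for every `r > 0`. [folklore] -/
theorem radialAmp_mul_pow_eq_const {l : ℕ} {a k : ℝ → ℝ} (ha : ∀ r, 0 < r → DifferentiableAt ℝ a r)
    (hdk : ∀ r, 0 < r → deriv k r = 0)
    (hdiv : ∀ r, 0 < r → r * deriv a r + ((l : ℝ) + 3) * a r + (l : ℝ) * deriv k r / r = 0) :
    ∀ r, 0 < r → a r * r ^ (l + 3) = a 1 := by
  have hode : ∀ r, 0 < r → r * deriv a r + ((l : ℝ) + 3) * a r = 0 := fun r hr => by
    have h := hdiv r hr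
    rwa [hdk r hr, mul_zero, zero_div, add_zero] at h
  have hfd : ∀ r, 0 < r → HasDerivAt (fun s => a s * s ^ (l + 3)) 0 r := by
    intro r hr
    have h : HasDerivAt (fun s => a s * s ^ (l + 3))
        (deriv a r * r ^ (l + 3) + a r * (((l + 3 : ℕ) : ℝ) * r ^ (l + 3 - 1))) r :=
      ((ha r hr).hasDerivAt).mul (hasDerivAt_pow (l + 3) r)
    rw [show l + 3 - 1 = l + 2 by omega] at h
    refine h.congr_deriv ?_
    push_cast
    calc deriv a r * r ^ (l + 3) + a r * (((l : ℝ) + 3) * r ^ (l + 2))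
        = r ^ (l + 2) * (r * deriv a r + ((l : ℝ) + 3) * a r) := by ring
      _ = 0 := by rw [hode r hr, mul_zero]
  have hdiff : DifferentiableOn ℝ (fun s => a s * s ^ (l + 3)) (Ioi 0) := fun r hr =>
    (hfd r hr).differentiableAt.differentiableWithinAt
  have hder : (Ioi (0 : ℝ)).EqOn (deriv fun s => a s * s ^ (l + 3)) 0 := fun r hr => (hfd r hr).deriv
  intro r hr
  have h := isOpen_Ioi.is_const_of_deriv_eq_zero isPreconnected_Ioi hdiff hder hr (zero_lt_one' ℝ)
  simpa using h

/-! ### The ODE branch -/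

/-- ★★ **THE `d ≡ 0` ODE BRANCH (kinematic).**  `a, k` differentiable on `(0,∞)`, `G` real-analytic on `(0,∞)` with `G = a − k′/r`
(vorticity amplitude of `(aP)•y + k•∇P`) and `r a′ + (l+3)a + l k′/r = 0` (divergence-free), `G·k ≡ 0` on `(0,∞)`, and `|G(r)|·r^l`
bounded on `(0,1)` (the vorticity `G(r)•(∇P × y)` is continuous at the centre).  Then `G ≡ 0` on `(0,∞)`. [folklore] -/
theorem odeBranch_vortAmp_eq_zero {l : ℕ} {a k G : ℝ → ℝ}
    (ha : ∀ r, 0 < r → DifferentiableAt ℝ a r) (hk : ∀ r, 0 < r → DifferentiableAt ℝ k r)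
    (hG : ∀ r, 0 < r → G r = a r - deriv k r / r)
    (hdiv : ∀ r, 0 < r → r * deriv a r + ((l : ℝ) + 3) * a r + (l : ℝ) * deriv k r / r = 0)
    (hGan : AnalyticOnNhd ℝ G (Ioi 0)) (hd : ∀ r, 0 < r → G r * k r = 0)
    (hbdd : ∃ C, ∀ r, 0 < r → r < 1 → |G r| * r ^ l ≤ C) :
    ∀ r, 0 < r → G r = 0 := by
  by_contra hne
  push Not at hne
  obtain ⟨r₀, hr₀, hG0⟩ := hne
  -- `k ≡ 0`, hence `k′ ≡ 0`, on `(0,∞)`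
  have hk0 : ∀ r, 0 < r → k r = 0 :=
    eq_zero_of_analytic_mul_eq_zero hGan hr₀ hG0 (fun r hr => (hk r hr).continuousAt) hd
  have hdk : ∀ r, 0 < r → deriv k r = 0 := by
    intro r hr
    have h : k =ᶠ[𝓝 r] fun _ => (0 : ℝ) := by
      filter_upwards [Ioi_mem_nhds hr] with s hs using hk0 s hs
    rw [h.deriv_eq, deriv_const]
  -- `G = a = a(1)·r^{−(l+3)}` with `a 1 ≠ 0`
  have hGa : ∀ r, 0 < r → G r = a r := fun r hr => by rw [hG r hr, hdk r hr, zero_div, sub_zero]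
  have hconst := radialAmp_mul_pow_eq_const (l := l) ha hdk hdiv
  have hC : a 1 ≠ 0 := by
    intro h0
    apply hG0
    rw [hGa r₀ hr₀]
    have h := hconst r₀ hr₀
    rw [h0] at h
    exact (mul_eq_zero.mp h).resolve_right (pow_ne_zero _ hr₀.ne')
  -- boundedness at `0⁺` is violated: `|a 1| ≤ C r³` for all small `r`
  obtain ⟨C, hCb⟩ := hbdd
  have hev : ∀ᶠ r in 𝓝[>] (0 : ℝ), |a 1| ≤ C * r ^ 3 := by
    filter_upwards [Ioo_mem_nhdsGT (zero_lt_one' ℝ)] with r hr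
    have hr0 : 0 < r := hr.1
    have h := hCb r hr0 hr.2
    rw [hGa r hr0] at h
    have har : a r = a 1 / r ^ (l + 3) := by
      rw [eq_div_iff (pow_ne_zero _ hr0.ne')]
      exact hconst r hr0
    rw [har, abs_div, abs_of_pos (pow_pos hr0 _), div_mul_eq_mul_div, div_le_iff₀ (pow_pos hr0 _)] at h
    -- h : |a 1| * r ^ l ≤ C * r ^ (l + 3)
    have hrl : 0 < r ^ l := pow_pos hr0 _
    have h' : |a 1| * r ^ l ≤ (C * r ^ 3) * r ^ l := by
      calc |a 1| * r ^ l ≤ C * r ^ (l + 3) := h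
        _ = (C * r ^ 3) * r ^ l := by ring
    exact le_of_mul_le_mul_right h' hrl
  have hlim : Tendsto (fun r : ℝ => C * r ^ 3) (𝓝[>] (0 : ℝ)) (𝓝 0) := by
    have h : Tendsto (fun r : ℝ => C * r ^ 3) (𝓝 0) (𝓝 (C * 0 ^ 3)) :=
      ((continuous_const.mul (continuous_pow 3)).tendsto 0)
    rw [zero_pow three_ne_zero, mul_zero] at h
    exact h.mono_left nhdsWithin_le_nhds
  have hle : |a 1| ≤ 0 := le_of_tendsto_of_tendsto tendsto_const_nhds hlim hev
  exact hC (abs_nonpos_iff.mp hle)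

/-! ### Corollary with the (E3) extraction: the slice alternative -/

/-- ★★ **THE SLICE ALTERNATIVE OF THE EVEN RUNG.**  `Y` a nonzero solid harmonic of degree `l ≥ 2`; radial coefficients `a k G c e`
at one time slice with `a, k` differentiable and `G` real-analytic on `(0,∞)`, `G = a − k′/r`, the divergence relation
`r a′ + (l+3)a + l k′/r = 0`, `c, e` differentiable on `(0,∞)`, `|G(r)|·r^l` bounded on `(0,1)`; and the single-degree vorticity identity
`−(c(‖y‖)Y)•(∇Y × y) − (G(‖y‖)k(‖y‖))•(∇|∇Y|² × y) − e(‖y‖)•(∇Y × y) = 0` for `y ≠ 0` (coefficient `d = G·k`, hand p800175).  Then EITHER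
`G ≡ 0` on `(0,∞)` (the slice's vorticity `G•(∇Y × y)` vanishes off the centre) OR `l = 2` and `Y` is zonal. [folklore] -/
theorem evenRung_slice_alternative {l : ℕ} {Y : EuclideanSpace ℝ (Fin 3) → ℝ} (hl : 2 ≤ l) (hY : IsSolidHarmonic l Y)
    (hne : ∃ y, Y y ≠ 0) {a k G c e : ℝ → ℝ}
    (ha : ∀ r, 0 < r → DifferentiableAt ℝ a r) (hk : ∀ r, 0 < r → DifferentiableAt ℝ k r)
    (hG : ∀ r, 0 < r → G r = a r - deriv k r / r)
    (hdiv : ∀ r, 0 < r → r * deriv a r + ((l : ℝ) + 3) * a r + (l : ℝ) * deriv k r / r = 0)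
    (hGan : AnalyticOnNhd ℝ G (Ioi 0))
    (hc : ∀ r, 0 < r → DifferentiableAt ℝ c r) (he : ∀ r, 0 < r → DifferentiableAt ℝ e r)
    (hbdd : ∃ C, ∀ r, 0 < r → r < 1 → |G r| * r ^ l ≤ C)
    (hid : ∀ y : EuclideanSpace ℝ (Fin 3), y ≠ 0 →
      -((c ‖y‖ * Y y) • cross (gradient Y y) y) -
        (G ‖y‖ * k ‖y‖) • cross (gradient (fun z => ⟪gradient Y z, gradient Y z⟫) y) y -
        e ‖y‖ • cross (gradient Y y) y = 0) :
    (∀ r, 0 < r → G r = 0) ∨ (l = 2 ∧ IsZonal Y) := by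
  have hdd : ∀ r, 0 < r → DifferentiableAt ℝ (fun s => G s * k s) r := fun r hr =>
    ((hGan r hr).differentiableAt).mul (hk r hr)
  rcases evenRung_dichotomy_of_lamb_identity (d := fun s => G s * k s) hl hY hne hc hdd he hid with h | h
  · exact Or.inl (odeBranch_vortAmp_eq_zero ha hk hG hdiv hGan h hbdd)
  · exact Or.inr h

end Summit.NavierStokesRegularity.NavierStokesRegularity.Theorems.PoloidalLiouville.Antidynamo

end
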